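import Literature.NumberTheory.Automorphic.AutomorphicRepsGL
import HarnessLib

/-!
# Pure Hodge infinity types and the unramified shadow of essential self-duality

Topic `Literature/NumberTheory/Automorphic`; definitions requested by the route
`Summit.Langlands.Langlands.Theses.GSpinRung` (items `stmt-Langlands-3391/3393/3394/3395`, work item
`defn-HasHodgeInfinityType`), which inline the two predicates below verbatim.

## Contents

* `InfinityType.IsPureOfHodgeType T w H` — `T : InfinityType K n` is *pure of (motivic) weight `w`
  with Hodge–Tate multiset `H : Multiset ℤ` at every embedding*: for all `σ : K →+* ℂ`,
  `T.hodgeTateWeights σ = H` (tree normalisation: the parameter `z ↦ z^a z̄^b` contributes `-a`)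
  and `a + b = -w` for every `(a, b) ∈ T σ`; i.e. `T σ = {(-p, -q) : p + q = w}`, `H` = the `p`'s —
  the parameter of a pure motive of weight `w` (Clozel 1990, §3.3 and the purity lemma 4.9;
  Buzzard–Gee, Def. 5.7/5.10 and the Hodge–Tate recipe, Remark 5.18, printed LMS numbering).
* `AutomorphicRepData.HasHodgeInfinityType π w H := ∃ T, π.HasInfinityType T ∧ T.IsPureOfHodgeType w H`;
  `hasHodgeInfinityType_iff` unfolds it to the text inlined by the route.
* API: such `T` are L-algebraic (`….isLAlgebraic`); `T` is regular iff `H` has no repeated entry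
  (`isRegular_iff`), so a repeated weight excludes the regular (cohomological) types of
  `Literature.Barriers.Langlands.NonRegularWeightBarrier` (`not_isRegularAlgebraic`); `card H = n`
  and Hodge symmetry `H = w - H` for well-formed `T` (`card_eq`, `map_sub_eq`); the explicit type
  `InfinityType.ofHodge w H`, well formed when `card H = n ∧ H = w - H`; the route's province
  `n = 6`, `w = 3`, `H = {0,1,1,2,2,3}` (Hodge vector `(1,2,2,1)`): `isWellFormed_ofHodge_weightThree`,
  `not_isRegular_of_isPureOfHodgeType_weightThree`, `hasHodgeInfinityType_weightThree_iff`.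
* `AutomorphicRepData.IsEssentiallySelfDualAE π` — the unramified shadow of essential self-duality
  `π ≅ π^∨ ⊗ (χ ∘ det)` (Barnet-Lamb–Gee–Geraghty–Taylor 2014, §2.1, "RAESDC"): at almost every
  finite place every Satake parameter `α` of `π` satisfies `{c · α_i⁻¹} = {α_i}` for some `c ∈ ℂ`
  (`c = χ_v(ϖ_v)`: `π^∨` has Satake parameter `α⁻¹`, Getz–Hahn 2024, Prop. 7.6.2, and a twist
  multiplies it by `χ_v(ϖ_v)`, tree `HasSatakeParamAt.twist`), and the lemma deriving it from a
  "contragredient-twist" datum nearly equivalent to `π` (`isEssentiallySelfDualAE_of_nearlyEquivalent`).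

## Design notes

* `HasInfinityType T` reads only the multisets of `a`-exponents of `T` (`AutomorphicRepsGL`, D3):
  the pairing `(a, b)`, hence the purity clause, is carried by the witness `T`, as in the route's
  inlined text; its content on `π` is `card H = n`, `H = w - H` and "parameter `-H` at every `σ`".
* `IsEssentiallySelfDualAE` is implied by, and strictly weaker than, `π ≅ π^∨ ⊗ (χ ∘ det)` (`c` may
  vary with `v`); no converse is asserted.  Nothing here is a named fact: definitions and proved
  lemmas only.

## References

* K. Buzzard, T. Gee, *The conjectural connections between automorphic representations and Galois
  representations*, LMS Lecture Note Ser. 414 (2014), 135–187: §2.3 Def. 5.7, §3.1 Def. 5.10,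
  §3.2 Conj. 5.16–5.17 and Remark 5.18. [`BuzzardGeeLMS2014`]
* L. Clozel, *Motifs et formes automorphes*, Ann Arbor proceedings I (1990): §3.3, Déf. 3.12,
  Lemme 4.9 (pureté). [`Clozel1990`]
* T. Barnet-Lamb, T. Gee, D. Geraghty, R. Taylor, *Potential automorphy and change of weight*,
  Ann. of Math. 179 (2014), §2.1. [`BarnetlambEtAl2014`]
* J. Getz, H. Hahn, *An Introduction to Automorphic Representations*, GTM 300 (2024), Prop. 7.6.2.
  [`GetzHahn2024`]
-/

noncomputable section

open scoped Classical
open NumberField IsDedekindDomain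

namespace Literature.NumberTheory.Automorphic

/-! ## Pure Hodge infinity types (parameter side) -/

namespace InfinityType

variable {K : Type*} [Field K] {n : ℕ}

/-- The infinity type `T` is **pure of weight `w` with Hodge–Tate multiset `H` at every
embedding**: for every `σ : K →+* ℂ`, `T.hodgeTateWeights σ = H` (the weight `(a, b)`, parameter
`z ↦ z^a z̄^b`, contributes `-a`) and every `(a, b) ∈ T σ` satisfies `a + b = -w`.  Equivalently
`T σ = {(-p, -(w - p)) : p ∈ H}`: the parameter `z ↦ z^{-p} z̄^{-q}`, `p + q = w`, of a pure
Hodge structure of weight `w` with Hodge numbers `h^{p,w-p}` = multiplicities of `H` (Clozel 1990,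
§3.3 and the purity lemma 4.9: `p_i + q_i = w` for cuspidal algebraic `π`; Buzzard–Gee, Remark 5.18:
`λ_σ`, here `{a_i}`, is the Hodge–Tate cocharacter, up to the sign fixed in `hodgeTateWeights`).
[cite: BuzzardGeeLMS2014, §3.2 Remark 5.18 and §2.3 Def. 5.7] -/
def IsPureOfHodgeType (T : InfinityType K n) (w : ℤ) (H : Multiset ℤ) : Prop :=
  ∀ σ : K →+* ℂ, T.hodgeTateWeights σ = H.map (↑) ∧ ∀ p ∈ T σ, p.a + p.b = -w

namespace IsPureOfHodgeType

variable {T : InfinityType K n} {w : ℤ} {H : Multiset ℤ}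

/-- The Hodge–Tate weights of a pure Hodge infinity type at any embedding are `H`. [folklore] -/
theorem hodgeTateWeights_eq (h : T.IsPureOfHodgeType w H) (σ : K →+* ℂ) :
    T.hodgeTateWeights σ = H.map (↑) :=
  (h σ).1

/-- The purity relation `a + b = -w` for every weight of a pure Hodge infinity type. [folklore] -/
theorem add_eq (h : T.IsPureOfHodgeType w H) (σ : K →+* ℂ) {p : ArchWeight} (hp : p ∈ T σ) :
    p.a + p.b = -w :=
  (h σ).2 p hp

/-- Every `a`-exponent of a pure Hodge infinity type is (minus) an entry of `H`, in particular an
integer. [folklore] -/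
theorem exists_int_a_eq (h : T.IsPureOfHodgeType w H) (σ : K →+* ℂ) {p : ArchWeight}
    (hp : p ∈ T σ) : ∃ m : ℤ, m ∈ H ∧ p.a = -(m : ℂ) := by
  have hmem : -p.a ∈ T.hodgeTateWeights σ := Multiset.mem_map.mpr ⟨p, hp, rfl⟩
  rw [h.hodgeTateWeights_eq σ] at hmem
  obtain ⟨m, hm, hm'⟩ := Multiset.mem_map.mp hmem
  exact ⟨m, hm, by rw [hm', neg_neg]⟩

/-- **A pure Hodge infinity type is L-algebraic**: `a = -p ∈ ℤ` and `b = -w - a ∈ ℤ`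
(Buzzard–Gee, Def. 5.7 / 5.10: `λ_σ ∈ X^*(T)`). [cite: BuzzardGeeLMS2014, §2.3 Def. 5.7 and §3.1 Def. 5.10] -/
theorem isLAlgebraic (h : T.IsPureOfHodgeType w H) : T.IsLAlgebraic := by
  intro σ p hp
  obtain ⟨m, -, hm⟩ := h.exists_int_a_eq σ hp
  refine ⟨-m, -w + m, by rw [hm, Int.cast_neg], ?_⟩
  have hab := h.add_eq σ hp
  rw [hm] at hab
  rw [Int.cast_add, Int.cast_neg]
  linear_combination hab

/-- If `H` has no repeated entry, a pure Hodge infinity type with multiset `H` is regular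
(pairwise distinct `a`-exponents at every embedding). [cite: Clozel1990, Définition 3.12] -/
theorem isRegular (h : T.IsPureOfHodgeType w H) (hH : H.Nodup) : T.IsRegular := by
  intro σ
  have h1 : (T.hodgeTateWeights σ).Nodup := by
    rw [h.hodgeTateWeights_eq σ]
    exact hH.map Int.cast_injective
  have h2 : T.hodgeTateWeights σ = ((T σ).map ArchWeight.a).map Neg.neg := by
    simp [hodgeTateWeights, Multiset.map_map]
  rw [h2] at h1
  exact Multiset.Nodup.of_map _ h1

/-- If a pure Hodge infinity type is regular then `H` has no repeated entry (an embedding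
`K →+* ℂ` must exist, e.g. `K` a number field). [cite: Clozel1990, Définition 3.12] -/
theorem nodup [Nonempty (K →+* ℂ)] (h : T.IsPureOfHodgeType w H) (hT : T.IsRegular) :
    H.Nodup := by
  obtain ⟨σ⟩ := ‹Nonempty (K →+* ℂ)›
  have h1 := hT.nodup_hodgeTateWeights σ
  rw [h.hodgeTateWeights_eq σ] at h1
  exact Multiset.Nodup.of_map _ h1

/-- **Regularity is read off from the Hodge–Tate multiset**: a pure Hodge infinity type is regular
iff `H` has no repeated entry. [cite: Clozel1990, Définition 3.12] -/
theorem isRegular_iff [Nonempty (K →+* ℂ)] (h : T.IsPureOfHodgeType w H) :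
    T.IsRegular ↔ H.Nodup :=
  ⟨h.nodup, h.isRegular⟩

/-- **A repeated Hodge–Tate weight excludes regularity** — hence all the regular algebraic
(cohomological) types of `Literature.Barriers.Langlands.NonRegularWeightBarrier`.
[cite: Clozel1990, Définition 3.12] -/
theorem not_isRegular [Nonempty (K →+* ℂ)] (h : T.IsPureOfHodgeType w H) (hH : ¬ H.Nodup) :
    ¬ T.IsRegular :=
  fun hT ↦ hH (h.nodup hT)

/-- With a repeated Hodge–Tate weight the type is not regular algebraic in Clozel's sense.
[cite: Clozel1990, Définitions 1.8 and 3.12] -/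
theorem not_isRegularAlgebraic [Nonempty (K →+* ℂ)] (h : T.IsPureOfHodgeType w H)
    (hH : ¬ H.Nodup) : ¬ T.IsRegularAlgebraic :=
  fun hT ↦ h.not_isRegular hH hT.2

/-- For a pure Hodge infinity type with `n` weights at each embedding (e.g. a well-formed one),
`H` has `n` entries. [folklore] -/
theorem card_eq (h : T.IsPureOfHodgeType w H) {σ : K →+* ℂ} (hσ : Multiset.card (T σ) = n) :
    Multiset.card H = n := by
  have h1 := congrArg Multiset.card (h.hodgeTateWeights_eq σ)
  simp only [hodgeTateWeights, Multiset.card_map] at h1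
  rw [← h1, hσ]

/-- **Hodge symmetry.** For a *well-formed* pure Hodge infinity type (weights at `σ̄` are the
swaps of those at `σ`) the Hodge–Tate multiset is symmetric about `w / 2`: `{w - p : p ∈ H} = H`
(`h^{p,q} = h^{q,p}`): the weights at `σ̄` are the `-b = w + a`. [cite: BuzzardGeeLMS2014, §2.3] -/
theorem map_sub_eq [Nonempty (K →+* ℂ)] (h : T.IsPureOfHodgeType w H) (hT : T.IsWellFormed) :
    H.map (fun p ↦ w - p) = H := by
  obtain ⟨σ⟩ := ‹Nonempty (K →+* ℂ)›
  apply Multiset.map_injective (Int.cast_injective (α := ℂ))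
  change (H.map fun p ↦ w - p).map (Int.cast : ℤ → ℂ) = H.map (Int.cast : ℤ → ℂ)
  have hconj := h.hodgeTateWeights_eq (NumberField.ComplexEmbedding.conjugate σ)
  simp only [hodgeTateWeights, hT.2 σ, Multiset.map_map, Function.comp_def,
    ArchWeight.swap_a] at hconj
  have hb : ∀ p ∈ T σ, -p.b = (w : ℂ) + p.a := fun p hp ↦ by
    linear_combination -(h.add_eq σ hp)
  have hσ := h.hodgeTateWeights_eq σ
  simp only [hodgeTateWeights] at hσ
  calc (H.map fun p ↦ w - p).map (Int.cast : ℤ → ℂ)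
      = (H.map (Int.cast : ℤ → ℂ)).map (fun z ↦ (w : ℂ) - z) := by
        simp [Multiset.map_map]
    _ = ((T σ).map fun p ↦ -p.a).map (fun z ↦ (w : ℂ) - z) := by rw [hσ]
    _ = (T σ).map (fun p ↦ -p.b) := by
        rw [Multiset.map_map]
        refine Multiset.map_congr rfl fun p hp ↦ ?_
        simp only [Function.comp_apply, hb p hp]
        ring
    _ = H.map (Int.cast : ℤ → ℂ) := hconj

end IsPureOfHodgeType

/-! ### The explicit pure Hodge infinity type attached to `(w, H)` -/

/-- The archimedean weight `(-p, p - w)`, i.e. the parameter `z ↦ z^{-p} z̄^{-(w-p)}` of the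
Hodge type `(p, w - p)` (`a - b = w - 2p ∈ ℤ`). [cite: BuzzardGeeLMS2014, §2.3] -/
def hodgeArchWeight (w p : ℤ) : ArchWeight where
  a := -(p : ℂ)
  b := (p : ℂ) - w
  exists_int_sub := ⟨w - 2 * p, by push_cast; ring⟩

/-- The `a`-exponent of `hodgeArchWeight w p` is `-p`. [folklore] -/
@[simp] theorem hodgeArchWeight_a (w p : ℤ) : (hodgeArchWeight w p).a = -(p : ℂ) := rfl

/-- The `b`-exponent of `hodgeArchWeight w p` is `p - w`. [folklore] -/
@[simp] theorem hodgeArchWeight_b (w p : ℤ) : (hodgeArchWeight w p).b = (p : ℂ) - w := rfl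

/-- Swapping `hodgeArchWeight w p` gives `hodgeArchWeight w (w - p)` (complex conjugation
exchanges the Hodge types `(p, q)` and `(q, p)`). [folklore] -/
theorem swap_hodgeArchWeight (w p : ℤ) :
    (hodgeArchWeight w p).swap = hodgeArchWeight w (w - p) := by
  ext
  · simp only [ArchWeight.swap_a, hodgeArchWeight_a, hodgeArchWeight_b, Int.cast_sub]; ring
  · simp only [ArchWeight.swap_b, hodgeArchWeight_a, hodgeArchWeight_b, Int.cast_sub]; ring

variable (K n) in
/-- The **pure Hodge infinity type** of weight `w` and Hodge–Tate multiset `H`: at every embedding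
the weights `{(-p, p - w) : p ∈ H}` (parameters `z ↦ z^{-p} z̄^{-(w-p)}`).  It is pure of Hodge
type `(w, H)` (`isPureOfHodgeType_ofHodge`) and well formed when `card H = n` and `H = w - H`
(`isWellFormed_ofHodge`). [cite: BuzzardGeeLMS2014, §2.3 and §3.2 Remark 5.18] -/
def ofHodge (w : ℤ) (H : Multiset ℤ) : InfinityType K n :=
  fun _ ↦ H.map (hodgeArchWeight w)

/-- Unfolding `ofHodge` at an embedding. [folklore] -/
@[simp] theorem ofHodge_apply (w : ℤ) (H : Multiset ℤ) (σ : K →+* ℂ) :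
    ofHodge K n w H σ = H.map (hodgeArchWeight w) := rfl

/-- The Hodge–Tate weights of `ofHodge w H` at every embedding are `H`. [folklore] -/
theorem hodgeTateWeights_ofHodge (w : ℤ) (H : Multiset ℤ) (σ : K →+* ℂ) :
    (ofHodge K n w H).hodgeTateWeights σ = H.map (↑) := by
  simp [hodgeTateWeights, Multiset.map_map]

/-- `ofHodge w H` is pure of weight `w` with Hodge–Tate multiset `H`. [folklore] -/
theorem isPureOfHodgeType_ofHodge (w : ℤ) (H : Multiset ℤ) :
    (ofHodge K n w H).IsPureOfHodgeType w H := by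
  refine fun σ ↦ ⟨hodgeTateWeights_ofHodge w H σ, fun p hp ↦ ?_⟩
  obtain ⟨m, -, rfl⟩ := Multiset.mem_map.mp hp
  simp only [hodgeArchWeight_a, hodgeArchWeight_b]
  ring

/-- `ofHodge w H` is well formed as soon as `H` has `n` entries and is symmetric about `w / 2`
(`{w - p : p ∈ H} = H`, Hodge symmetry): then the weights at `σ̄` — the same multiset — are the
swaps of the weights at `σ`. [cite: BuzzardGeeLMS2014, §2.3] -/
theorem isWellFormed_ofHodge {w : ℤ} {H : Multiset ℤ} (hcard : Multiset.card H = n)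
    (hsymm : H.map (fun p ↦ w - p) = H) : (ofHodge K n w H).IsWellFormed := by
  refine ⟨fun σ ↦ by simp [hcard], fun σ ↦ ?_⟩
  simp only [ofHodge_apply, Multiset.map_map, Function.comp_def, swap_hodgeArchWeight]
  conv_lhs => rw [← hsymm]
  rw [Multiset.map_map, Function.comp_def]

/-! ### The route's province: weight `3`, Hodge–Tate weights `{0,1,1,2,2,3}` on `GL₆` -/

/-- Hodge symmetry of `{0,1,1,2,2,3}` in weight `3`: `{3 - p} = {0,1,1,2,2,3}`. [folklore] -/
theorem map_sub_weightThreeHodge :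
    ({0, 1, 1, 2, 2, 3} : Multiset ℤ).map (fun p ↦ 3 - p) = {0, 1, 1, 2, 2, 3} := by
  decide

/-- `{0,1,1,2,2,3}` has repeated entries. [folklore] -/
theorem not_nodup_weightThreeHodge : ¬ ({0, 1, 1, 2, 2, 3} : Multiset ℤ).Nodup := by
  decide

/-- The integer multiset `{0,1,1,2,2,3}` cast to `ℂ` is the complex multiset `{0,1,1,2,2,3}`
(bridge to the route's inlined text, which writes the Hodge–Tate weights in `Multiset ℂ`).
[folklore] -/
theorem map_intCast_weightThreeHodge :
    ({0, 1, 1, 2, 2, 3} : Multiset ℤ).map (Int.cast : ℤ → ℂ) = {0, 1, 1, 2, 2, 3} := by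
  simp

/-- **Non-vacuity of the province's infinity type**: the pure Hodge infinity type of weight `3`
and Hodge–Tate weights `{0,1,1,2,2,3}` on `GL₆` (parameters `z^0 z̄^{-3}, z^{-1} z̄^{-2} (×2),
z^{-2} z̄^{-1} (×2), z^{-3} z̄^0` at every embedding) is well formed. [folklore] -/
theorem isWellFormed_ofHodge_weightThree :
    (ofHodge K 6 3 {0, 1, 1, 2, 2, 3}).IsWellFormed :=
  isWellFormed_ofHodge rfl map_sub_weightThreeHodge

/-- In the province `(w, H) = (3, {0,1,1,2,2,3})` no pure Hodge infinity type is regular: the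
weights `1` and `2` are doubled (the case excluded from
`Literature.Barriers.Langlands.NonRegularWeightBarrier`'s cohomological types). [cite: Clozel1990, Définition 3.12] -/
theorem not_isRegular_of_isPureOfHodgeType_weightThree [Nonempty (K →+* ℂ)]
    {T : InfinityType K 6} (h : T.IsPureOfHodgeType 3 {0, 1, 1, 2, 2, 3}) : ¬ T.IsRegular :=
  h.not_isRegular not_nodup_weightThreeHodge

end InfinityType

/-! ## Automorphic side -/

namespace AutomorphicRepData

variable {n : ℕ} {K : Type} [Field K] [NumberField K] {hcpt : isCompact_glFiniteIntegralLevel n K}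

/-- `π` **has a pure infinity type of weight `w` with Hodge–Tate weights `H` at every
embedding**: some infinity type `T` of `π` (`HasInfinityType`: well formed, with `a`-multisets the
archimedean parameter of `π`) is pure of Hodge type `(w, H)` (`InfinityType.IsPureOfHodgeType`:
`T.hodgeTateWeights σ = H` and `a + b = -w` on `T σ`, all `σ`), i.e. `π_∞` has the parameter
`z ↦ z^{-p} z̄^{-q}`, `p + q = w`, `p ∈ H`, expected of the automorphic representation attached to
a pure motive of weight `w` with Hodge–Tate weights `H` (Buzzard–Gee, Conj. 5.16 and Remark 5.18,
L-normalisation; Clozel 1990, §3.3 and Lemme 4.9).  `HasInfinityType` reads only the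
`a`-multisets, so the purity pairing is carried by the witness `T` (content on `π`: `card_eq`,
`map_sub_eq`). [cite: BuzzardGeeLMS2014, §3.2 Conj. 5.16 and Remark 5.18] -/
def HasHodgeInfinityType (π : AutomorphicRepData (AutomorphyDatum.gl n K hcpt)) (w : ℤ)
    (H : Multiset ℤ) : Prop :=
  ∃ T : InfinityType K n, π.HasInfinityType T ∧ T.IsPureOfHodgeType w H

/-- Unfolding `HasHodgeInfinityType` to the text inlined by the route `GSpinRung`
(definitional). [folklore] -/
theorem hasHodgeInfinityType_iff (π : AutomorphicRepData (AutomorphyDatum.gl n K hcpt)) (w : ℤ)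
    (H : Multiset ℤ) :
    π.HasHodgeInfinityType w H ↔
      ∃ T : InfinityType K n, π.HasInfinityType T ∧
        ∀ σ : K →+* ℂ, T.hodgeTateWeights σ = H.map (↑) ∧ ∀ p ∈ T σ, p.a + p.b = -w :=
  Iff.rfl

/-- The province of the route `GSpinRung` (`n = 6`, `w = 3`, `H = {0,1,1,2,2,3}`), with the
Hodge–Tate weights written as a complex multiset exactly as the route inlines them. [folklore] -/
theorem hasHodgeInfinityType_weightThree_iff {hcpt : isCompact_glFiniteIntegralLevel 6 K}
    (π : AutomorphicRepData (AutomorphyDatum.gl 6 K hcpt)) :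
    π.HasHodgeInfinityType 3 {0, 1, 1, 2, 2, 3} ↔
      ∃ T : InfinityType K 6, π.HasInfinityType T ∧
        ∀ σ : K →+* ℂ, T.hodgeTateWeights σ = {0, 1, 1, 2, 2, 3} ∧ ∀ w ∈ T σ, w.a + w.b = -3 := by
  simp only [hasHodgeInfinityType_iff, InfinityType.map_intCast_weightThreeHodge]
  norm_num

namespace HasHodgeInfinityType

variable {π : AutomorphicRepData (AutomorphyDatum.gl n K hcpt)} {w : ℤ} {H : Multiset ℤ}

/-- **A representation with a pure Hodge infinity type is L-algebraic** (the wanted lemma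
`HasHodgeInfinityType ⇒ IsLAlgebraic`). [cite: BuzzardGeeLMS2014, §3.1 Def. 5.10] -/
theorem isLAlgebraic (h : π.HasHodgeInfinityType w H) : π.IsLAlgebraic := by
  obtain ⟨T, hT, hpure⟩ := h
  exact ⟨T, hT, hpure.isLAlgebraic⟩

/-- The Hodge–Tate multiset of a representation of `GL_n` with a pure Hodge infinity type has `n`
entries. [folklore] -/
theorem card_eq (h : π.HasHodgeInfinityType w H) : Multiset.card H = n := by
  obtain ⟨T, hT, hpure⟩ := h
  obtain ⟨σ⟩ : Nonempty (K →+* ℂ) := inferInstance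
  exact hpure.card_eq (hT.1.1 σ)

/-- **Hodge symmetry** `{w - p : p ∈ H} = H` for a representation with a pure Hodge infinity
type (the witness is well formed). [cite: BuzzardGeeLMS2014, §2.3] -/
theorem map_sub_eq (h : π.HasHodgeInfinityType w H) : H.map (fun p ↦ w - p) = H := by
  obtain ⟨T, hT, hpure⟩ := h
  exact hpure.map_sub_eq hT.1

/-- If `H` has a repeated entry, no infinity type of `π` that is pure of Hodge type `(w, H)` is
regular algebraic (Clozel): such `π` fall outside the cohomological technique class of
`Literature.Barriers.Langlands.NonRegularWeightBarrier`. [cite: Clozel1990, Définitions 1.8 and 3.12] -/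
theorem not_isRegularAlgebraic_of_not_nodup (hH : ¬ H.Nodup) {T : InfinityType K n}
    (_hT : π.HasInfinityType T) (hpure : T.IsPureOfHodgeType w H) : ¬ T.IsRegularAlgebraic :=
  hpure.not_isRegularAlgebraic hH

end HasHodgeInfinityType

/-! ## The unramified shadow of essential self-duality -/

/-- `π` is **essentially self-dual at almost all unramified places** (the unramified shadow of
`π ≅ π^∨ ⊗ (χ ∘ det)`, Barnet-Lamb–Gee–Geraghty–Taylor 2014, §2.1, "essentially self dual"): for
all but finitely many finite places `v`, every Satake parameter `α = {α₁, …, α_n}` of `π` at `v`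
satisfies `{c · α₁⁻¹, …, c · α_n⁻¹} = {α₁, …, α_n}` for some `c ∈ ℂ`.  If `π ≅ π^∨ ⊗ (χ ∘ det)`
this holds with `c = χ_v(ϖ_v)` wherever `π` and `χ` are unramified (`π^∨` has Satake parameter
`α⁻¹`, Getz–Hahn 2024, Prop. 7.6.2, tree `CuspidalAutomorphicRepData.exists_contragredient_satake`;
a twist multiplies it by `χ_v(ϖ_v)`, tree `HasSatakeParamAt.twist`); the predicate is strictly
weaker than essential self-duality (`c` may vary with `v`). [cite: BarnetlambEtAl2014, §2.1] -/
def IsEssentiallySelfDualAE (π : AutomorphicRepData (AutomorphyDatum.gl n K hcpt)) : Prop :=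
  ∀ᶠ v : HeightOneSpectrum (𝓞 K) in Filter.cofinite, ∀ α : Multiset ℂ,
    π.HasSatakeParamAt v α → ∃ c : ℂ, α.map (fun z ↦ c * z⁻¹) = α

variable {π : AutomorphicRepData (AutomorphyDatum.gl n K hcpt)}

/-- The everywhere form implies the almost-everywhere form. [folklore] -/
theorem IsEssentiallySelfDualAE.of_forall
    (h : ∀ (v : HeightOneSpectrum (𝓞 K)) (α : Multiset ℂ),
      π.HasSatakeParamAt v α → ∃ c : ℂ, α.map (fun z ↦ c * z⁻¹) = α) :
    π.IsEssentiallySelfDualAE :=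
  Filter.Eventually.of_forall h

/-- **From an essentially contragredient datum to the unramified shadow.**  Suppose `π'` is a
datum carrying, at almost every `v`, the Satake parameters `{c_v · α_i⁻¹}` whenever `π` has
Satake parameter `α` at `v` (as does `π^∨ ⊗ (χ ∘ det)` with `c_v = χ_v(ϖ_v)`: Getz–Hahn 2024,
Prop. 7.6.2 and the tree's `HasSatakeParamAt.twist`), that `π` and `π'` are nearly equivalent
(which for cuspidal data is `π ≅ π'` by strong multiplicity one), and that Satake parameters of
`π` and `π'` are unique (the named facts `hasSatakeParamAt_unique`).  Then `π` is essentially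
self-dual at almost all places. [cite: BarnetlambEtAl2014, §2.1] -/
theorem isEssentiallySelfDualAE_of_nearlyEquivalent
    {π' : AutomorphicRepData (AutomorphyDatum.gl n K hcpt)} (c : HeightOneSpectrum (𝓞 K) → ℂ)
    (hc : ∀ᶠ v : HeightOneSpectrum (𝓞 K) in Filter.cofinite, ∀ α : Multiset ℂ,
      π.HasSatakeParamAt v α → π'.HasSatakeParamAt v (α.map fun z ↦ c v * z⁻¹))
    (hne : π.IsNearlyEquivalent π') (hu : π.hasSatakeParamAt_unique)
    (hu' : π'.hasSatakeParamAt_unique) : π.IsEssentiallySelfDualAE := by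
  filter_upwards [hc, hne] with v hcv hnev α hα
  obtain ⟨β, hβ, hβ'⟩ := hnev
  refine ⟨c v, ?_⟩
  rw [hu hα hβ]
  exact hu' (hcv β hβ) hβ'

end AutomorphicRepData

end Literature.NumberTheory.Automorphic

end
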